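import Literature.MathematicalPhysics.QuantumFieldTheory.Balaban1983to89.Node00.Record12BgRowCoClassGauge
import Literature.MathematicalPhysics.QuantumFieldTheory.Balaban1983to89.Node00.TorusCoverGaugeTokensR
import Literature.MathematicalPhysics.QuantumFieldTheory.Balaban1983to89.B12Membership314

/-!
# NODE 00 — [15] (168) AT THE OBJECTS OF RECORD: a local gauge with small potential letters `|A|, |∇^ξA| < t` on a site set `Y`
# (def-P11's `Sect2.LocalGaugeOn Y ξ t U` = [I] (1.12) ∕ [15] (9) line 1 in ∃-form) BOUNDS THE PLAQUETTE VARIABLES INSIDE `Y`: `|U(∂p) − 1| < 32·t·ξ²`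

Cell `pub-ymgap`, seat `pub-ymgap-dag-n07-e` generation 12 (R141 (C), DAG node N07 = [15]; cell INBOX INTENT-31 of 2026-08-27).  NEW leaf, PROOF kind (no `def`);
node00-def-P11's FILE 14 `Node00.Record12BgRowCoClassGauge` (`Sect2.LocalGaugeOn`), this seat's FILE 29 `Node00.TorusCoverGaugeTokensR` (`Gauge152OfClassTopStepR`,
`Gauge9RegSepTopStepR`) and pub-balaban's `B12Membership314` (`condIII_expMul`: the four-exponential plaquette estimate behind [I] p. 272 ∕ [6] (1.54)) CONSUMED BY
NAME, nothing modified.  `--supports stmt-QuantumFields-20541` (K0⁷).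

WHY.  Print's LAST STEP of Sect. F ((168) p. 304 [PDF 28]): *«We take Δ = Δ₀ … and we have this inequality [(167): |A|, |∇^ηA|, … < ε′(L^jη)^{−1,−2,…}] … This and
the inequality (1.54) of [6] imply |U₁(∂p) − 1| < ε′ + 86dε′² < 2ε′ on Δ₀ (168) for ε′ small … Again using the fact that U₁ is a gauge transformed U′_k on Δ₀, and
that the conditions (2) are gauge invariant, we conclude that U′_k satisfies (2) on Δ₀»* — i.e. SMALL POTENTIAL LETTERS IN SOME GAUGE ⇒ SMALL PLAQUETTE VARIABLES, by
the exponential chart and gauge invariance.  At NODE 00's objects the letters are def-P11's clause `Sect2.LocalGaugeOn Y ξ t U` (`∃ u A, (ι∘U)^{ι∘u} = e^{iξA}` on the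
bonds of `Y`, `‖A‖ < t` there, `‖∇^ξ_μ A_ν‖ < t` on the derivative stencils of `Y`) — the CONCLUSION letter of this seat's (152)∕(9) tokens (`Gauge152OfClassTopStep(R)`,
`Gauge9RegSepTopStep(R)`) and the HYPOTHESIS letter of [I] (1.12) (`CondI.localGauge`).  This file proves the step in kernel: on every plaquette with its four
corners in `Y`, `dist1 (U(∂p)) < 32·t·ξ²` (`0 < ξ ≤ 1`, `32t ≤ 1`; the constant 32 is `B12Membership314.budget314`'s, print's is 2).  USES: (a) the interface a
future discharge of `HalvingStepTop` (module 30, `Node00.CriticalOnFibreTopHalving`) meets at its last line; (b) a CONSISTENCY link between the K0 road's two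
step tokens — the (9)-letters on a grid cube bound that cube's interior plaquettes at `32·B₃′δ_n·η_n²`, the (1.7)-half of (8) up to the constant (§3).

CONTENTS.  §1 `plaqHol_gaugeAct_conj_SU` (`(U^u)(∂p) = u(x)·U(∂p)·u(x)⁻¹`), `dist1_plaqHol_gaugeAct_SU` (gauge invariance of `|U(∂p) − 1|`), `ιSU_plaqHol_gaugeAct_SU` (the
embedded plaquette of `U^u` is the product of the four `gaugeU (ι∘u) (ι∘U)` letters).  §2 ★★ `dist1_plaqHol_lt_of_localGaugeOn`, ★★ `plaqSmallOn_of_localGaugeOn`.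
§3 ★ `plaqSmallOn_cube_of_gauge152R`, ★ `plaqSmallOn_cube_of_gauge9R` (one grid cube of the tokens' families).

HONEST FRAMING: kernel lemmas about the tree's own objects (matrix exponential estimate + gauge invariance); NOTHING of Bałaban's analysis asserted or proved
beyond this elementary step; the tokens of §3 remain HYPOTHESES (named facts, never asserted); K0⁷ ∕ V14 stub 1 NOT closed; N07 NOT discharged; counts
unmoved (5∕27); one finite T⁴ programme at fixed ε — NOT continuum ∕ ℝ⁴ ∕ OS ∕ mass gap ∕ Clay.  No `sorry`, no `def`, no `instance`, no `notation`.
-/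

noncomputable section

open scoped Matrix.Norms.L2Operator

namespace Literature.MathematicalPhysics.QuantumFieldTheory.Balaban1983to89.Node00

open Complex (I)
open NormedSpace
open T4Continuum (T4Family)
open B15DeterminingSets
open B12RegularSpaces111 (gaugeU expI grad)

/-! ## §1  Gauge covariance of the plaquette variable at the objects of record -/

section GaugeCovariance

variable {P : Params} {N : ℕ} [NeZero N]

/-- `(U^u)(∂p) = u(x)·U(∂p)·u(x)⁻¹` for `p = p_{μν}(x)` (B7 (12): the plaquette variable is gauge COVARIANT). [cite: Balaban1985Averaging, (9),(12) p.19] -/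
theorem plaqHol_gaugeAct_conj_SU (u : GaugeTransf P 0 (SU N)) (U : GaugeField P 0 (SU N)) (p : Plaq P 0) :
    GaugeField.plaqHol (GaugeField.gaugeAct u U) p = u p.src * GaugeField.plaqHol U p * (u p.src)⁻¹ := by
  simp only [GaugeField.plaqHol, GaugeField.gaugeAct, PBond.tgt]
  rw [Site.shift_comm p.src p.ν p.μ]
  group

/-- **Gauge invariance of `|U(∂p) − 1|`** (print, p. 304: *«the conditions (2) are gauge invariant»*). [cite: Balaban1985Variational, (2) p.278, p.304; Balaban1985Averaging, (12)–(13) p.19] -/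
theorem dist1_plaqHol_gaugeAct_SU (u : GaugeTransf P 0 (SU N)) (U : GaugeField P 0 (SU N)) (p : Plaq P 0) :
    dist1 (GaugeField.plaqHol (GaugeField.gaugeAct u U) p) = dist1 (GaugeField.plaqHol U p) := by
  rw [plaqHol_gaugeAct_conj_SU]
  exact GaugeGroup.dist1_conj _ _

/-- The embedded plaquette variable of `U^u` is the product of the four letters `(ι∘U)^{ι∘u}(b)`, `b ⊂ ∂p`, of r11's `gaugeU` (the letter of `Sect2.LocalGaugeOn`).
[cite: Balaban1987RG1, (1.10) p.262; Balaban1985Averaging, (9) p.19 (bookkeeping)] -/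
theorem ιSU_plaqHol_gaugeAct_SU (u : GaugeTransf P 0 (SU N)) (U : GaugeField P 0 (SU N)) (p : Plaq P 0) :
    ιSU N (GaugeField.plaqHol (GaugeField.gaugeAct u U) p) =
      gaugeU (fun x => ιSU N (u x)) (fun b => ιSU N (U b)) ⟨p.src, p.μ⟩ *
        gaugeU (fun x => ιSU N (u x)) (fun b => ιSU N (U b)) ⟨p.src.shift p.μ, p.ν⟩ *
        (gaugeU (fun x => ιSU N (u x)) (fun b => ιSU N (U b)) ⟨p.src.shift p.ν, p.μ⟩)⁻¹ *
        (gaugeU (fun x => ιSU N (u x)) (fun b => ιSU N (U b)) ⟨p.src, p.ν⟩)⁻¹ := by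
  simp only [GaugeField.plaqHol, GaugeField.gaugeAct, gaugeU, map_mul, map_inv]

end GaugeCovariance

/-! ## §2  ★★ Small potential letters in a gauge ⇒ small plaquette variables ([15] (168) ∕ [6] (1.54) at the objects of record) -/

section LocalGaugePlaquette

variable {P : Params} {N : ℕ} [NeZero N]

/-- ★★ **[15] (168) AT THE OBJECTS OF RECORD.**  If `U` admits a local gauge on the site set `Y` with potential letters `‖A(b)‖ < t` on the bonds of `Y` and
`‖∇^ξ_μ A_ν(x)‖ < t` on the derivative stencils of `Y` (`Sect2.LocalGaugeOn Y ξ t U`), with `0 < ξ ≤ 1` and `32·t ≤ 1`, then every plaquette `p` with its four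
corners in `Y` has `|U(∂p) − 1| < 32·t·ξ²`.  PROOF: gauge invariance (§1) moves to `U^u`; its embedded plaquette variable is
`e^{iξA₁}e^{iξA₂}e^{−iξA₃}e^{−iξA₄}` with `A₁ = A_μ(x)`, `A₂ = A_ν(x+e_μ)`, `A₃ = A_μ(x+e_ν)`, `A₄ = A_ν(x)`; `B12Membership314.condIII_expMul` at the trivial
background (`U_i = 1`, `α₂ := t`, `α₀ := 32t`) bounds its distance to `1` by `32t·ξ²` from `‖A₁‖, ‖A₄‖ < t` and the two stencil bounds
`‖ξ⁻¹(A₂ − A₄)‖ = ‖∇^ξ_μA_ν(x)‖ < t`, `‖ξ⁻¹(A₃ − A₁)‖ = ‖∇^ξ_νA_μ(x)‖ < t`.  Print's constant is 2 («ε′ + 86dε′² < 2ε′»); 32 is the tree's budget.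
[cite: Balaban1985Variational, (168) p.304, (2) p.278; Balaban1985RegularSpaces, (1.54) p.85; Balaban1987RG1, (1.12) p.262, p.272] -/
theorem dist1_plaqHol_lt_of_localGaugeOn {Y : Set (Site P 0)} {ξ t : ℝ} {U : GaugeField P 0 (SU N)} (h : Sect2.LocalGaugeOn Y ξ t U)
    (hξ : 0 < ξ) (hξ1 : ξ ≤ 1) (ht : 32 * t ≤ 1) {p : Plaq P 0} (hp : p ∈ plaqInside Y) :
    dist1 (GaugeField.plaqHol U p) < 32 * t * ξ ^ 2 := by
  obtain ⟨u, A, he, hA, hdA⟩ := h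
  obtain ⟨h1, h2, h3, h4⟩ := hp
  have h4' : (p.src.shift p.ν).shift p.μ ∈ Y := by rw [← Site.shift_comm]; exact h4
  -- the four bonds of `∂p` and the two derivative stencils lie in the region of `Y`
  have hb1 : (⟨p.src, p.μ⟩ : PBond P 0) ∈ (Sect2.regionOfSet P Y).bonds := ⟨h1, h2⟩
  have hb2 : (⟨p.src.shift p.μ, p.ν⟩ : PBond P 0) ∈ (Sect2.regionOfSet P Y).bonds := ⟨h2, h4⟩
  have hb3 : (⟨p.src.shift p.ν, p.μ⟩ : PBond P 0) ∈ (Sect2.regionOfSet P Y).bonds := ⟨h3, h4'⟩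
  have hb4 : (⟨p.src, p.ν⟩ : PBond P 0) ∈ (Sect2.regionOfSet P Y).bonds := ⟨h1, h3⟩
  have hq1 : ((p.src, p.μ, p.ν) : Site P 0 × Fin P.d × Fin P.d) ∈ (Sect2.regionOfSet P Y).dpairs := ⟨h1, h2, h3, h4⟩
  have hq2 : ((p.src, p.ν, p.μ) : Site P 0 × Fin P.d × Fin P.d) ∈ (Sect2.regionOfSet P Y).dpairs := ⟨h1, h3, h2, h4'⟩
  -- positivity of the thresholds
  have ht0 : 0 < t := (norm_nonneg _).trans_lt (hA _ hb1)
  -- gauge invariance: pass to `U^u`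
  rw [← dist1_plaqHol_gaugeAct_SU u U p, dist1_su_eq_norm, ← coe_ιSU, ιSU_plaqHol_gaugeAct_SU, he _ hb1, he _ hb2, he _ hb3, he _ hb4]
  -- the embedded plaquette of `U^u` is the product of the four exponentials
  have hval : (((expI ξ (A ⟨p.src, p.μ⟩) * expI ξ (A ⟨p.src.shift p.μ, p.ν⟩) * (expI ξ (A ⟨p.src.shift p.ν, p.μ⟩))⁻¹ *
      (expI ξ (A ⟨p.src, p.ν⟩))⁻¹ : (MatA N)ˣ)) : MatA N) =
      (exp ((I * ξ) • A ⟨p.src, p.μ⟩) * ((1 : (MatA N)ˣ) : MatA N)) * (exp ((I * ξ) • A ⟨p.src.shift p.μ, p.ν⟩) * ((1 : (MatA N)ˣ) : MatA N)) *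
        ((((1 : (MatA N)ˣ)⁻¹ : (MatA N)ˣ) : MatA N) * exp (-((I * ξ) • A ⟨p.src.shift p.ν, p.μ⟩))) *
        ((((1 : (MatA N)ˣ)⁻¹ : (MatA N)ˣ) : MatA N) * exp (-((I * ξ) • A ⟨p.src, p.ν⟩))) := by
    simp only [Units.val_one, inv_one, mul_one, one_mul]
    rfl
  rw [hval]
  -- the stencil bounds in the shape `condIII_expMul` reads
  have hDμ : ‖(ξ : ℂ)⁻¹ • (((1 : (MatA N)ˣ) : MatA N) * A ⟨p.src.shift p.μ, p.ν⟩ * (((1 : (MatA N)ˣ)⁻¹ : (MatA N)ˣ) : MatA N) - A ⟨p.src, p.ν⟩)‖ < t := by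
    simpa only [Units.val_one, inv_one, one_mul, mul_one, grad] using hdA _ hq1
  have hDν : ‖(ξ : ℂ)⁻¹ • (((1 : (MatA N)ˣ) : MatA N) * A ⟨p.src.shift p.ν, p.μ⟩ * (((1 : (MatA N)ˣ)⁻¹ : (MatA N)ˣ) : MatA N) - A ⟨p.src, p.μ⟩)‖ < t := by
    simpa only [Units.val_one, inv_one, one_mul, mul_one, grad] using hdA _ hq2
  have hU : ‖((1 : (MatA N)ˣ) : MatA N) * ((1 : (MatA N)ˣ) : MatA N) * (((1 : (MatA N)ˣ)⁻¹ : (MatA N)ˣ) : MatA N) *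
      (((1 : (MatA N)ˣ)⁻¹ : (MatA N)ˣ) : MatA N) - 1‖ < 1 / 2 * (32 * t) * ξ ^ 2 := by
    simp only [Units.val_one, inv_one, mul_one, sub_self, norm_zero]
    positivity
  have hmain := B12Membership314.condIII_expMul hξ hξ1 ht (le_refl (32 * t)) (A ⟨p.src, p.μ⟩) (A ⟨p.src.shift p.μ, p.ν⟩)
    (A ⟨p.src.shift p.ν, p.μ⟩) (A ⟨p.src, p.ν⟩) (1 : (MatA N)ˣ) 1 1 1 hU (hA _ hb1) (hA _ hb4) hDμ hDν
  simpa only [mul_assoc] using hmain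

/-- ★★ **SMALL POTENTIAL LETTERS IN A GAUGE ⇒ (1.7) INSIDE THE REGION**: `Sect2.LocalGaugeOn Y ξ t U`, `0 < ξ ≤ 1`, `32t ≤ 1` give `PlaqSmallOn (plaqInside Y) (32·t·ξ²) U`.
[cite: Balaban1985Variational, (168) p.304, (2) p.278; Balaban1985RegularSpaces, (1.7) p.77, (1.54) p.85] -/
theorem plaqSmallOn_of_localGaugeOn {Y : Set (Site P 0)} {ξ t : ℝ} {U : GaugeField P 0 (SU N)} (h : Sect2.LocalGaugeOn Y ξ t U)
    (hξ : 0 < ξ) (hξ1 : ξ ≤ 1) (ht : 32 * t ≤ 1) : PlaqSmallOn (plaqInside Y) (32 * t * ξ ^ 2) U :=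
  fun _ hp => dist1_plaqHol_lt_of_localGaugeOn h hξ hξ1 ht hp

end LocalGaugePlaquette

/-! ## §3  ★ The K0 road's (152) ∕ (9) step tokens bound the interior plaquettes of their grid cubes (consistency with (8)'s (1.7)-half, up to the constant) -/

section Tokens

variable {F : T4Family} {N : ℕ} [NeZero N]

/-- `0 < η_n ≤ 1` on the lattices of record (`η_n = L^{−n}`, `L ≥ 1`). [cite: Balaban1987RG1, (1.1) p.260 (bookkeeping)] -/
private theorem eta_pos_le_one (P : Params) (n : ℕ) : 0 < P.eta n ∧ P.eta n ≤ 1 := by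
  have hL : (1 : ℝ) ≤ P.L := by exact_mod_cast P.L_pos
  unfold Params.eta
  exact ⟨pow_pos (inv_pos.mpr (lt_of_lt_of_le one_pos hL)) n, pow_le_one₀ (inv_nonneg.mpr (zero_le_one.trans hL)) (inv_le_one_of_one_le₀ hL)⟩

/-- ★ **THE (152)-TOKEN BOUNDS THE INTERIOR PLAQUETTES OF ITS CUBES**: under the binders of `Gauge152OfClassTopStepR F N Sup M c B₉ a₀` (a class member on a separated
index with the floor `c ≤ ν.M₁`), on every non-wrapping grid cube `□` of side `side L M n` or `side L M (n+1)` inside `Ω_n` the (152)-letters give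
`PlaqSmallOn (plaqInside □) (32·B₉ε_n·η_n²) U` whenever `32·B₉ε_n ≤ 1` — [6] Thm 2's gauge read back on the curvature, print's (168).  The token stays a HYPOTHESIS.
[cite: Balaban1985Variational, (152) p.301, (168) p.304; Balaban1985RegularSpaces, (1.36) p.82, (1.54) p.85] -/
theorem plaqSmallOn_cube_of_gauge152R {Sup : (ν : Stage7Numerics) → (K : ℕ) → (ℕ → Set (Site (F.P K) 0)) → Set (Site (F.P K) 0)} {M c : ℕ} {B₉ a₀ : ℝ}
    (h : Gauge152OfClassTopStepR F N Sup M c B₉ a₀) (ν : Stage7Numerics) (g : ℕ → ℝ) (K k : ℕ) (s : SeqOfRecord F ν M g K k)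
    (hsep : Sect2.SeqSeparated ν.M₁ s) (hM₁ : 0 < ν.M₁) (hc : c ≤ ν.M₁) (hk : 1 ≤ k) (ε : ℕ → ℝ)
    (hε : ∀ m, m ≤ k → 0 < ε m ∧ ε m ≤ a₀) (hcomp : ∀ m, m < k → ε m ≤ 2 * ε (m + 1)) (hcomp' : ∀ m, m < k → ε (m + 1) ≤ 2 * ε m)
    (U : GaugeField (F.P K) 0 (SU N))
    (hP : ∀ m, m ≤ k → PlaqSmallOn (Sect2.omegaPlaqsTop s.Ω (Sup ν K s.Ω) m) (ε m * (F.P K).eta m ^ 2) U)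
    (hD : ∀ m, m ≤ k → Sect2.CoDivSmallOn (Sect2.omegaBondsTop s.Ω (Sup ν K s.Ω) m) (ε m * (F.P K).eta m ^ 3) U)
    {n : ℕ} (hn1 : 1 ≤ n) (hnk : n ≤ k) {S : ℕ}
    (hS : S = B14.Eq213MaximalDomains.side (F.P K).L M n ∨ S = B14.Eq213MaximalDomains.side (F.P K).L M (n + 1)) (hSN : (S : ℤ) < (F.P K).sitesPerDir 0)
    {a : Fin (F.P K).d → ℤ} (ha : a ∈ cubeIndices (F.P K) S) (hΩ : cubeEnl (F.P K) S a 0 ⊆ s.Ω n) (hsmall : 32 * (B₉ * ε n) ≤ 1) :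
    PlaqSmallOn (plaqInside (cubeEnl (F.P K) S a 0)) (32 * (B₉ * ε n) * (F.P K).eta n ^ 2) U := by
  obtain ⟨u, A, he, hA, hdA⟩ := h ν g K k s hsep hM₁ hc hk ε hε hcomp hcomp' U hP hD n hn1 hnk S hS hSN a ha hΩ
  exact plaqSmallOn_of_localGaugeOn ⟨u, A, he, hA, hdA⟩ (eta_pos_le_one (F.P K) n).1 (eta_pos_le_one (F.P K) n).2 hsmall

/-- ★ **THE (9)-STEP TOKEN BOUNDS THE INTERIOR PLAQUETTES OF ITS CUBES AT `32·B₃′δ_n·η_n²`** — the (1.7)-half of (8) on the cube up to the constant `32·B₃′` in place of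
`B₃`: under the binders of `Gauge9RegSepTopStepR F N Sup M c B₃ B₃' a₀ a₁` (critical configuration on the fibre, data (7), class (6) at `ε₀`), on every non-wrapping grid
cube `□ ⊆ Ω_n` of the two families, `PlaqSmallOn (plaqInside □) (32·B₃′δ_n·η_n²) U` whenever `32·B₃′δ_n ≤ 1`.  A CONSISTENCY link between the K0 road's two step tokens
((9) line 1 and (8)); the token stays a HYPOTHESIS. [cite: Balaban1985Variational, Thm 1 (8)–(9) p.279, (168) p.304; Balaban1985RegularSpaces, (1.7) p.77, (1.54) p.85] -/
theorem plaqSmallOn_cube_of_gauge9R {Sup : (ν : Stage7Numerics) → (K : ℕ) → (ℕ → Set (Site (F.P K) 0)) → Set (Site (F.P K) 0)} {M c : ℕ} {B₃ B₃' a₀ a₁ : ℝ}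
    (h : Gauge9RegSepTopStepR F N Sup M c B₃ B₃' a₀ a₁) (ν : Stage7Numerics) (g : ℕ → ℝ) (K k : ℕ) (s : SeqOfRecord F ν M g K k)
    (hsep : Sect2.SeqSeparated ν.M₁ s) (hM₁ : 0 < ν.M₁) (hc : c ≤ ν.M₁) (hk : 1 ≤ k) (ε₀ : ℝ) (δ : ℕ → ℝ)
    (hδ : ∀ n, n ≤ k → 0 < δ n ∧ δ n ≤ a₁ ∧ B₃ * δ n ≤ ε₀) (hcomp : ∀ n, n < k → δ n ≤ 2 * δ (n + 1))
    (hcomp' : ∀ n, n < k → δ (n + 1) ≤ 2 * δ n) (hε₀ : ε₀ ≤ a₀) (W : MSField (F.P K) (SU N))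
    (h7 : Sect2.DataSmall7PTop (avOfRecord F N K) s.Ω (Sup ν K s.Ω) k δ W) (U : GaugeField (F.P K) 0 (SU N))
    (h17 : ∀ n, n ≤ k → PlaqSmallOn (Sect2.omegaPlaqsTop s.Ω (Sup ν K s.Ω) n) (ε₀ * (F.P K).eta n ^ 2) U)
    (h19 : Sect2.CoDivClassOnTop s.Ω (Sup ν K s.Ω) k ε₀ U) (hfib : AgreeOn (genSet s.Ω k) (avgFamily (avOfRecord F N K) U) W)
    (hcrit : IsCritOnFibre F N K (genSet s.Ω k) W U) {n : ℕ} (hn1 : 1 ≤ n) (hnk : n ≤ k) {S : ℕ}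
    (hS : S = B14.Eq213MaximalDomains.side (F.P K).L M n ∨ S = B14.Eq213MaximalDomains.side (F.P K).L M (n + 1)) (hSN : (S : ℤ) < (F.P K).sitesPerDir 0)
    {a : Fin (F.P K).d → ℤ} (ha : a ∈ cubeIndices (F.P K) S) (hΩ : cubeEnl (F.P K) S a 0 ⊆ s.Ω n) (hsmall : 32 * (B₃' * δ n) ≤ 1) :
    PlaqSmallOn (plaqInside (cubeEnl (F.P K) S a 0)) (32 * (B₃' * δ n) * (F.P K).eta n ^ 2) U := by
  obtain ⟨u, A, he, hA, hdA⟩ :=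
    h ν g K k s hsep hM₁ hc hk ε₀ δ hδ hcomp hcomp' hε₀ W h7 U h17 h19 hfib hcrit n hn1 hnk S hS hSN a ha hΩ
  exact plaqSmallOn_of_localGaugeOn ⟨u, A, he, hA, hdA⟩ (eta_pos_le_one (F.P K) n).1 (eta_pos_le_one (F.P K) n).2 hsmall

end Tokens

end Literature.MathematicalPhysics.QuantumFieldTheory.Balaban1983to89.Node00

end
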